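import Literature.IUT.HodgeArakelov.GaloisPairCyclotomesCompatibleOfGalois
import Literature.AnabelianGeometry.AbsoluteAnabelian.AbsTopIII.CyclotomeAutomorphisms
import HarnessLib

/-!
# [IUTchII] Cor. 1.11 (b): under (HGAL), the residual (C′) at `γ` is EQUIVALENT to (HCYC)_levels at `(γ, τ)`
# (converse of `compatible_of_galois`; G-w5d145-2 ⟺ the cyclotomic half of G-w5d169-3)

Mochizuki, *Inter-universal Teichmüller theory II*, §1, Cor. 1.11 (b), kurims manuscript (Dec. 2020) p. 49
[claim: Mochizuki2012, status: disputed] (IUTchII §1 Cor 1.11, kurims p.49); [AbsTopIII] Cor. 1.10 (c) p. 42; [EtTh] Cor. 2.19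
(i)/(iii) pp. 64–65. abc-iut cell, layer L6, node `IUTchII:Cor1.11`; seat abc-iut-w5-d145 (gen 4), support chain
«CW5D145-CONSOLIDATE» piece P4b for GAP-LEDGER **G-w5d145-2** / **G-w5d169-3**. PROOF-ONLY, 0 defs.

`compatible_of_galois` (P4, p440299): (HGAL) ∧ (HCYC)_levels at `(γ, τ)` ⟹ (C′) at `γ`. THIS FILE proves the converse under
(HGAL): `EtaleLevels.hcyc_of_compatible` — if `γ` lies over `Inn(τ)|_{G_K}` and SOME comparison `c : μ_Ẑ(Π^tp_{X̲̲}/Δ) ⥲ (l·Δ_Θ)(𝕄_*)`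
is compatible at `γ`, then `γ̄_{μ,n} = galMuN τ` at every level (every `n`-th root of unity of `ℚ̄_p` is a coordinate of an element of
`Λ(ℚ̄_pˣ)`, abc-iut-L4's `MLFClosure.cyclotome_exists_apply_eq`; then compare the `n`-th coordinates of the two sides of (C′)
through `t`: `τ·a` by P2b, `γ̄_{μ,n}(a)` by P3); and the packaged equivalence `compatible_iff_hcyc_of_hgal`:
**under (HGAL) at `(γ, τ)`, (C′) at `γ` (for some, equivalently every, `c`) ⟺ (HCYC)_levels at `(γ, τ)`.** So, granted the Galois
side (HGAL) ([AbsTopIII] Cor. 1.10: `γ ↦` a `γ̄`-semilinear field automorphism of `k̄`, hence an element of `G_{ℚ_p}`), the typed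
residual of node IUTchII:Cor1.11 and the cyclotomic residual of node IUTchII:Prop3.4(i) (P3) are THE SAME statement. No new `Prop`
fact; nothing of another seat restated; nothing here bears on [IUTchIII] Cor. 3.12; typed ≠ discharged.
-/

noncomputable section

namespace Literature.IUT.HodgeArakelov

open CategoryTheory
open Literature.AnabelianGeometry.AbsoluteAnabelian

namespace EtaleLevels

open Literature.AnabelianGeometry.EtaleTheta Literature.AnabelianGeometry.SemiGraphs
open scoped Literature.AnabelianGeometry.EtaleTheta

variable {p : ℕ} [Fact p.Prime] {D : Literature.AnabelianGeometry.EtaleTheta.ThetaSetting p}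
  {E : D.EtaleThetaData} {l : ℕ} (C : E.DoubleUnderline l) (hC : D.Compat) (hS : D.Sec2Hyps)
  (hl : l.Prime) (hp2 : p ≠ 2) (hpl : p ≠ l) (hζ : ∃ ζ : D.K, IsPrimitiveRoot ζ (4 * l))
  (mods : ∀ M : ℕ+, D.CyclotomeMod l M)
  (f : contCocycles D.toTheta D.DeltaTheta C.GtpYdduu) (hf : f ∈ C.rootCocycles hC)
  (hmods : ∀ (M M' : ℕ+) (h : (M : ℕ) ∣ (M' : ℕ)) (x : D.lDeltaTheta l),
    MuN.red p M M' h ((mods M').red x) = (mods M).red x)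
  (h15 : Literature.AnabelianGeometry.EtaleTheta.ThetaSetting.Prop15iii E hC) (L : C.CuspLabels)
  (hZ : ∀ M : ℕ+, Nonempty (ModelCyclotomes.lDeltaQuot (C.rigidData (mods M) hC hS h15 L) ≃*
    Literature.IUT.HodgeTheaters.ZHat))
  (h218i : ∀ M : ℕ+, (levelRigid C hC hS mods h15 L M).Cor218_i)
  [CompactSpace (setting C hC hS hl hp2 hpl hζ mods f hf).Gk] (A : AbsTopMonoids (setting C hC hS hl hp2 hpl hζ mods f hf))

/-- Every `n`-th root of unity of `ℚ̄_p` is the `n`-th coordinate of an element of `Λ(ℚ̄_pˣ) = Ẑ(1)` (abc-iut-L4's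
`MLFClosure.cyclotome_exists_apply_eq` at the standard closure datum of `ℚ_p`, whose `k̄` IS `ℚ̄_p`).
[cite: MochizukiAbsTopIII2015, Definition 3.1 (v) p.69] -/
theorem exists_cyclotome_apply_eq_muN (n : ℕ+) (a : MuN p n) :
    ∃ ξ : Literature.AnabelianGeometry.EtaleTheta.cyclotome (AlgebraicClosure ℚ_[p])ˣ,
      (ξ : ℕ+ → (AlgebraicClosure ℚ_[p])ˣ) n = ((a : MuN p n) : (PadicAlgCl p)ˣ) := by
  letI : IsNonarchimedeanLocalField ℚ_[p] := Literature.NumberTheory.GaloisRepresentations.Padic.isNonarchimedeanLocalField_holds p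
  exact MLFClosure.cyclotome_exists_apply_eq (MLFClosure.std ℚ_[p]) ((a : MuN p n) : (PadicAlgCl p)ˣ) n
    ((mem_rootsOfUnity _ _).mp a.2)

/-- **(HGAL) ∧ (C′ at `γ`, for SOME comparison) ⟹ (HCYC)_levels at `(γ, τ)`**: the coefficient automorphisms of `γ` ARE the
Galois action of `τ` on roots of unity at every level. [claim: Mochizuki2012, status: disputed] (IUTchII §1 Cor 1.11, kurims p.49) -/
theorem hcyc_of_compatible
    (γ : basePointLim C hC hS hl hp2 hpl hζ mods f hf hmods h15 L hZ ⟶ basePointLim C hC hS hl hp2 hpl hζ mods f hf hmods h15 L hZ)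
    (τ : GQp p)
    (hγ : ∀ x : (basePointLim C hC hS hl hp2 hpl hζ mods f hf hmods h15 L hZ).G,
      D.aug (Subtype.val (IsoClass.homIso γ x)) = τ * D.aug (Subtype.val x) * τ⁻¹)
    (hcomp : ∃ c : ↥(A.quotObj (basePointLim C hC hS hl hp2 hpl hζ mods f hf hmods h15 L hZ)).galCyclotome ≃*
        (baseDatumLim C hC hS hl hp2 hpl hζ mods f hf hmods h15 L hZ (h218i 1)).A,
      ∀ ζ : (A.quotObj (basePointLim C hC hS hl hp2 hpl hζ mods f hf hmods h15 L hZ)).galCyclotome,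
        c (IsoClass.galCyclotomeMap (A.quotMap γ) ζ) =
          (baseDatumLim C hC hS hl hp2 hpl hζ mods f hf hmods h15 L hZ (h218i 1)).rhoA (IsoClass.homIso γ) (c ζ))
    (n : ℕ+) (a : MuN p n) :
    ModelCyclotomes.coeffAut (S := levelSetting C hC hS hl hp2 hpl hζ mods f hf n) (levelRigid C hC hS mods h15 L n)
      (h218i n) (IsoClass.homIso γ) a = galMuN p n τ a := by
  obtain ⟨F, -, hF⟩ := exists_galCyclotome_basePointLim_natural C hC hS hl hp2 hpl hζ mods f hf hmods h15 L hZ A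
  obtain ⟨t, -, ht⟩ := exists_thetaSide_natural C hC hS hl hp2 hpl hζ mods f hf hmods h15 L hZ h218i
  obtain ⟨c, hc⟩ := hcomp
  obtain ⟨e⟩ := nonempty_baseDatumLim_A_mulEquiv_zHat C hC hS hl hp2 hpl hζ mods f hf hmods h15 L hZ (h218i 1)
  -- transfer (C′) at `γ` to the comparison `c₀ := F ≫ t⁻¹`
  set c₀ : ↥(A.quotObj (basePointLim C hC hS hl hp2 hpl hζ mods f hf hmods h15 L hZ)).galCyclotome ≃*
      (baseDatumLim C hC hS hl hp2 hpl hζ mods f hf hmods h15 L hZ (h218i 1)).A := F.trans t.symm with hc₀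
  have hc₀C : ∀ ζ, c₀ (IsoClass.galCyclotomeMap (A.quotMap γ) ζ) =
      (baseDatumLim C hC hS hl hp2 hpl hζ mods f hf hmods h15 L hZ (h218i 1)).rhoA (IsoClass.homIso γ) (c₀ ζ) := fun ζ => by
    have h1 : c₀ (IsoClass.galCyclotomeMap (A.quotMap γ) ζ) =
        (c.symm.trans c₀) (c (IsoClass.galCyclotomeMap (A.quotMap γ) ζ)) := by
      simp only [MulEquiv.trans_apply, MulEquiv.symm_apply_apply]
    have h2 : c₀ ζ = (c.symm.trans c₀) (c ζ) := by
      simp only [MulEquiv.trans_apply, MulEquiv.symm_apply_apply]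
    rw [h1, h2, hc]
    exact Literature.IUT.HodgeTheaters.ZHat.mulEquiv_apply_comm_of_mulEquiv e (c.symm.trans c₀)
      ((baseDatumLim C hC hS hl hp2 hpl hζ mods f hf hmods h15 L hZ (h218i 1)).rhoA (IsoClass.homIso γ)) (c ζ)
  -- realise `a` as the `n`-th coordinate of some `ξ ∈ Λ(ℚ̄_pˣ)`, `ξ = F ζ = t (c₀ ζ)`
  obtain ⟨ξ, hξ⟩ := exists_cyclotome_apply_eq_muN n a
  set ζ := F.symm ξ with hζdef
  have hFζ : F ζ = ξ := F.apply_symm_apply ξ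
  have h2 : t (c₀ ζ) = ξ := by
    rw [hc₀, MulEquiv.trans_apply, MulEquiv.apply_symm_apply, hFζ]
  have h1 : t (c₀ (IsoClass.galCyclotomeMap (A.quotMap γ) ζ)) = F (IsoClass.galCyclotomeMap (A.quotMap γ) ζ) := by
    rw [hc₀, MulEquiv.trans_apply, MulEquiv.apply_symm_apply]
  -- the theta side: the `n`-th coordinate of `t (ρ_A(γ) (c₀ ζ))` is `γ̄_{μ,n}(a)`
  obtain ⟨a', ha', hρ⟩ := ht (IsoClass.homIso γ) (c₀ ζ) n
  have haa : a' = a := by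
    apply Subtype.ext
    rw [h2] at ha'
    exact ha'.symm.trans hξ
  subst haa
  -- compare the `n`-th coordinates of the two sides of (C′) at `ζ` through `t`
  have key := congrArg (fun m : ↥(baseDatumLim C hC hS hl hp2 hpl hζ mods f hf hmods h15 L hZ (h218i 1)).A =>
    ((((t m : ↥(Literature.AnabelianGeometry.EtaleTheta.cyclotome (AlgebraicClosure ℚ_[p])ˣ)) :
      ℕ+ → (AlgebraicClosure ℚ_[p])ˣ) n : (AlgebraicClosure ℚ_[p])ˣ) : AlgebraicClosure ℚ_[p])) (hc₀C ζ)
  -- LHS = τ (ξ_n) = τ a ; RHS = γ̄_{μ,n}(a')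
  have hL : ((((t (c₀ (IsoClass.galCyclotomeMap (A.quotMap γ) ζ)) :
      ↥(Literature.AnabelianGeometry.EtaleTheta.cyclotome (AlgebraicClosure ℚ_[p])ˣ)) :
      ℕ+ → (AlgebraicClosure ℚ_[p])ˣ) n : (AlgebraicClosure ℚ_[p])ˣ) : AlgebraicClosure ℚ_[p]) =
      τ ((((a' : MuN p n) : (PadicAlgCl p)ˣ) : (PadicAlgCl p)ˣ) : AlgebraicClosure ℚ_[p]) := by
    rw [h1, hF γ τ hγ ζ n, hFζ, hξ]
  have hR : ((((t ((baseDatumLim C hC hS hl hp2 hpl hζ mods f hf hmods h15 L hZ (h218i 1)).rhoA (IsoClass.homIso γ) (c₀ ζ)) :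
      ↥(Literature.AnabelianGeometry.EtaleTheta.cyclotome (AlgebraicClosure ℚ_[p])ˣ)) :
      ℕ+ → (AlgebraicClosure ℚ_[p])ˣ) n : (AlgebraicClosure ℚ_[p])ˣ) : AlgebraicClosure ℚ_[p]) =
      (((ModelCyclotomes.coeffAut (S := levelSetting C hC hS hl hp2 hpl hζ mods f hf n) (levelRigid C hC hS mods h15 L n)
        (h218i n) (IsoClass.homIso γ) a' : MuN p n) : (PadicAlgCl p)ˣ) : AlgebraicClosure ℚ_[p]) := by
    rw [hρ]
  have hfin : (((ModelCyclotomes.coeffAut (S := levelSetting C hC hS hl hp2 hpl hζ mods f hf n) (levelRigid C hC hS mods h15 L n)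
        (h218i n) (IsoClass.homIso γ) a' : MuN p n) : (PadicAlgCl p)ˣ) : AlgebraicClosure ℚ_[p]) =
      (((galMuN p n τ a' : MuN p n) : (PadicAlgCl p)ˣ) : AlgebraicClosure ℚ_[p]) := by
    rw [← hR, ← key, hL, galMuN_apply_coe]
  exact Subtype.ext (Units.ext hfin)

/-- **Under (HGAL) at `(γ, τ)`: (C′) at `γ` ⟺ (HCYC)_levels at `(γ, τ)`** — the typed residual G-w5d145-2 of [IUTchII] Cor. 1.11
(b) (at `γ`) and the cyclotomic residual (HCYC) of [IUTchII] Prop. 3.4 (i) (P3) (G-w5d169-3, at `(γ, τ)`) are the same statement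
once `γ` lies over `Inn(τ)|_{G_K}` ([AbsTopIII] Cor. 1.10). [claim: Mochizuki2012, status: disputed] (IUTchII §1 Cor 1.11, kurims p.49) -/
theorem compatible_iff_hcyc_of_hgal
    (γ : basePointLim C hC hS hl hp2 hpl hζ mods f hf hmods h15 L hZ ⟶ basePointLim C hC hS hl hp2 hpl hζ mods f hf hmods h15 L hZ)
    (τ : GQp p)
    (hγ : ∀ x : (basePointLim C hC hS hl hp2 hpl hζ mods f hf hmods h15 L hZ).G,
      D.aug (Subtype.val (IsoClass.homIso γ x)) = τ * D.aug (Subtype.val x) * τ⁻¹) :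
    (∀ (c : ↥(A.quotObj (basePointLim C hC hS hl hp2 hpl hζ mods f hf hmods h15 L hZ)).galCyclotome ≃*
          (baseDatumLim C hC hS hl hp2 hpl hζ mods f hf hmods h15 L hZ (h218i 1)).A)
        (ζ : (A.quotObj (basePointLim C hC hS hl hp2 hpl hζ mods f hf hmods h15 L hZ)).galCyclotome),
        c (IsoClass.galCyclotomeMap (A.quotMap γ) ζ) =
          (baseDatumLim C hC hS hl hp2 hpl hζ mods f hf hmods h15 L hZ (h218i 1)).rhoA (IsoClass.homIso γ) (c ζ)) ↔
      ∀ (n : ℕ+) (a : MuN p n),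
        ModelCyclotomes.coeffAut (S := levelSetting C hC hS hl hp2 hpl hζ mods f hf n) (levelRigid C hC hS mods h15 L n)
          (h218i n) (IsoClass.homIso γ) a = galMuN p n τ a := by
  obtain ⟨c₁, -⟩ := exists_equivariant_iso C hC hS hl hp2 hpl hζ mods f hf hmods h15 L hZ (h218i 1) A
  exact ⟨fun h => hcyc_of_compatible C hC hS hl hp2 hpl hζ mods f hf hmods h15 L hZ h218i A γ τ hγ ⟨c₁, h c₁⟩,
    fun h c ζ => compatible_of_galois C hC hS hl hp2 hpl hζ mods f hf hmods h15 L hZ h218i A γ τ hγ h c ζ⟩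

end EtaleLevels

end Literature.IUT.HodgeArakelov

end
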